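import Summits.Parity.GeneralizedHardyLittlewood.Theorems.PrimeLevelFamEdgeMomentsBeyondDiagonalLayersBesselSeparation
import HarnessLib

/-!
# Route `PrimeLevelFamEdge`, crux K_A `MomentsBeyondDiagonal` (stmt-Parity-20007), line «petersson_layers» v4:
# the TRUNCATED LAYER BLOCK as a finite sum of BILINEAR-TYPE Kloosterman forms

At fixed orders `(i, j)`, divisors `(d₁, d₂)` and layer `r`, a Petersson layer block is (`…LayersHeckeReindex`,
`layer_eq_sum_divisors_first`) `Σ_{m₁,n₁,m₂,n₂} W(n₁,n₂)·(X₁(m₁)X₂(m₂)·κ(m₁n₁, m₂n₂))` with `κ = layerKernel q r`.  Replacing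
`κ` by its `K`-term Bessel truncation (`…LayersBesselSeparation`: `(2π/q)·r⁻¹S(a,b;qr)·Σ_{k<K} c_k (2π/(qr))^{2k+1}(√a)^{2k+1}(√b)^{2k+1}`)
the block becomes a finite sum over `k < K` of forms

  `C_k(q,r) · Σ_{m₁,n₁,m₂,n₂} [X₁(m₁)X₂(m₂)(√m₁√m₂)^{2k+1}] · [W(n₁,n₂)(√n₁√n₂)^{2k+1}] · S(m₁n₁, m₂n₂; qr)`

(`truncatedBlock_eq_sum_forms`) — the shape to which the product identity / unit swap (`…LayersKloostermanProduct`), the gcd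
extraction (`…LayersKloostermanScale`), the fibrewise regrouping and `ℓ²` bounds (`…LayersConvolutionL2`) and finally the
completion bound (`…LayersFourierBound`) or Pascadi's Thm 7.1 (`…LayersPascadiBridge`) apply.  Generic in the weights
`W : ℕ → ℕ → ℂ`, `X₁ X₂ : ℕ → ℂ` and the index sets, so that it serves the band, the far layers and the core alike.
Proof only (def-free helper); no layer is bounded here; K_A NOT proved; nothing about Landau–Siegel zeros.
-/

noncomputable section

open Finset
open scoped Real Nat
open Literature.NumberTheory.LFunctions

namespace Summit.Parity.GeneralizedHardyLittlewood.Theorems.MomentsBeyondDiagonal.Layers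

/-! ## §1. Linearity of the block in the kernel -/

/-- The block is additive in the kernel. [folklore] -/
theorem block_add (S₁ T₁ S₂ T₂ : Finset ℕ) (W : ℕ → ℕ → ℂ) (X₁ X₂ : ℕ → ℂ) (κ₁ κ₂ : ℕ → ℕ → ℂ) :
    ∑ m₁ ∈ S₁, ∑ n₁ ∈ T₁, ∑ m₂ ∈ S₂, ∑ n₂ ∈ T₂,
        W n₁ n₂ * (X₁ m₁ * X₂ m₂ * (κ₁ (m₁ * n₁) (m₂ * n₂) + κ₂ (m₁ * n₁) (m₂ * n₂))) =
      ∑ m₁ ∈ S₁, ∑ n₁ ∈ T₁, ∑ m₂ ∈ S₂, ∑ n₂ ∈ T₂, W n₁ n₂ * (X₁ m₁ * X₂ m₂ * κ₁ (m₁ * n₁) (m₂ * n₂)) +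
      ∑ m₁ ∈ S₁, ∑ n₁ ∈ T₁, ∑ m₂ ∈ S₂, ∑ n₂ ∈ T₂, W n₁ n₂ * (X₁ m₁ * X₂ m₂ * κ₂ (m₁ * n₁) (m₂ * n₂)) := by
  simp only [mul_add, Finset.sum_add_distrib]

/-- The block is linear in the kernel over finite sums of kernels. [folklore] -/
theorem block_sum_range (S₁ T₁ S₂ T₂ : Finset ℕ) (W : ℕ → ℕ → ℂ) (X₁ X₂ : ℕ → ℂ) (κ : ℕ → ℕ → ℕ → ℂ) (K : ℕ) :
    ∑ m₁ ∈ S₁, ∑ n₁ ∈ T₁, ∑ m₂ ∈ S₂, ∑ n₂ ∈ T₂,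
        W n₁ n₂ * (X₁ m₁ * X₂ m₂ * ∑ k ∈ range K, κ k (m₁ * n₁) (m₂ * n₂)) =
      ∑ k ∈ range K, ∑ m₁ ∈ S₁, ∑ n₁ ∈ T₁, ∑ m₂ ∈ S₂, ∑ n₂ ∈ T₂,
        W n₁ n₂ * (X₁ m₁ * X₂ m₂ * κ k (m₁ * n₁) (m₂ * n₂)) := by
  induction K with
  | zero => simp
  | succ K ih =>
    simp only [Finset.sum_range_succ]
    rw [← ih]
    exact block_add S₁ T₁ S₂ T₂ W X₁ X₂ (fun a b ↦ ∑ k ∈ range K, κ k a b) (κ K)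

/-- The block is homogeneous in the kernel. [folklore] -/
theorem block_const_mul (S₁ T₁ S₂ T₂ : Finset ℕ) (W : ℕ → ℕ → ℂ) (X₁ X₂ : ℕ → ℂ) (C : ℂ) (κ : ℕ → ℕ → ℂ) :
    ∑ m₁ ∈ S₁, ∑ n₁ ∈ T₁, ∑ m₂ ∈ S₂, ∑ n₂ ∈ T₂, W n₁ n₂ * (X₁ m₁ * X₂ m₂ * (C * κ (m₁ * n₁) (m₂ * n₂))) =
      C * ∑ m₁ ∈ S₁, ∑ n₁ ∈ T₁, ∑ m₂ ∈ S₂, ∑ n₂ ∈ T₂, W n₁ n₂ * (X₁ m₁ * X₂ m₂ * κ (m₁ * n₁) (m₂ * n₂)) := by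
  simp only [Finset.mul_sum]
  refine sum_congr rfl fun _ _ ↦ sum_congr rfl fun _ _ ↦ sum_congr rfl fun _ _ ↦ sum_congr rfl fun _ _ ↦ ?_
  ring

/-! ## §2. The separated Taylor kernel: variables split between the mollifier side and the AFE side -/

/-- `(√(mn))^e = (√m)^e (√n)^e` for naturals. [folklore] -/
theorem sqrt_natCast_mul_pow (m n e : ℕ) :
    Real.sqrt ((m * n : ℕ) : ℝ) ^ e = Real.sqrt m ^ e * Real.sqrt n ^ e := by
  rw [Nat.cast_mul, Real.sqrt_mul (Nat.cast_nonneg m), mul_pow]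

/-- **The `k`-th separated form**: with the kernel `a b ↦ S(a,b;c)·(√a)^{2k+1}(√b)^{2k+1}` the block equals
`Σ [X₁(m₁)X₂(m₂)(√m₁)^{2k+1}(√m₂)^{2k+1}]·[W(n₁,n₂)(√n₁)^{2k+1}(√n₂)^{2k+1}]·S(m₁n₁, m₂n₂; c)`. [folklore] -/
theorem block_taylor_term_eq (c : ℕ) [NeZero c] (S₁ T₁ S₂ T₂ : Finset ℕ) (W : ℕ → ℕ → ℂ) (X₁ X₂ : ℕ → ℂ) (k : ℕ) :
    ∑ m₁ ∈ S₁, ∑ n₁ ∈ T₁, ∑ m₂ ∈ S₂, ∑ n₂ ∈ T₂,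
        W n₁ n₂ * (X₁ m₁ * X₂ m₂ *
          (kloostermanSum c ((m₁ * n₁ : ℕ) : ZMod c) ((m₂ * n₂ : ℕ) : ZMod c) *
            ((Real.sqrt ((m₁ * n₁ : ℕ) : ℝ) ^ (2 * k + 1) * Real.sqrt ((m₂ * n₂ : ℕ) : ℝ) ^ (2 * k + 1) : ℝ) : ℂ))) =
      ∑ m₁ ∈ S₁, ∑ n₁ ∈ T₁, ∑ m₂ ∈ S₂, ∑ n₂ ∈ T₂,
        (X₁ m₁ * X₂ m₂ * ((Real.sqrt m₁ ^ (2 * k + 1) * Real.sqrt m₂ ^ (2 * k + 1) : ℝ) : ℂ)) *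
          (W n₁ n₂ * ((Real.sqrt n₁ ^ (2 * k + 1) * Real.sqrt n₂ ^ (2 * k + 1) : ℝ) : ℂ)) *
          kloostermanSum c ((m₁ * n₁ : ℕ) : ZMod c) ((m₂ * n₂ : ℕ) : ZMod c) := by
  refine sum_congr rfl fun m₁ _ ↦ sum_congr rfl fun n₁ _ ↦ sum_congr rfl fun m₂ _ ↦ sum_congr rfl fun n₂ _ ↦ ?_
  rw [sqrt_natCast_mul_pow, sqrt_natCast_mul_pow]
  push_cast
  ring

/-! ## §3. The truncated block -/

/-- **The `K`-truncated layer block as a sum of `K` separated forms** (`q, r ≥ 1`, `c = qr`):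
with the truncated kernel `κ_K(a,b) = (2π/q)·(r⁻¹·S(a,b;qr)·Σ_{k<K} c_k (2π/(qr))^{2k+1}(√a)^{2k+1}(√b)^{2k+1})`
(`c_k = (−1)^k/(k!(k+1)!)`; `…LayersBesselSeparation.norm_layerKernel_sub_truncation_le` controls `κ − κ_K`),
`Block(κ_K) = Σ_{k<K} (2π/q) r⁻¹ c_k (2π/(qr))^{2k+1} · Σ [X₁X₂(√m₁√m₂)^{2k+1}]·[W(√n₁√n₂)^{2k+1}]·S(m₁n₁, m₂n₂; qr)`.
[cite: DLMF, 10.2.2; KowalskiMichel2000, §2.4.2 p. 312] -/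
theorem truncatedBlock_eq_sum_forms (q r : ℕ) [NeZero (q * r)] (S₁ T₁ S₂ T₂ : Finset ℕ) (W : ℕ → ℕ → ℂ)
    (X₁ X₂ : ℕ → ℂ) (K : ℕ) :
    ∑ m₁ ∈ S₁, ∑ n₁ ∈ T₁, ∑ m₂ ∈ S₂, ∑ n₂ ∈ T₂,
        W n₁ n₂ * (X₁ m₁ * X₂ m₂ *
          ((2 * (π : ℂ) / (q : ℂ)) * ((r : ℂ)⁻¹ *
            kloostermanSum (q * r) ((m₁ * n₁ : ℕ) : ZMod (q * r)) ((m₂ * n₂ : ℕ) : ZMod (q * r)) *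
            ((∑ k ∈ range K, (-1 : ℝ) ^ k / ((k ! : ℝ) * ((k + 1)! : ℝ)) *
              ((2 * π / ((q : ℝ) * r)) ^ (2 * k + 1) * Real.sqrt ((m₁ * n₁ : ℕ) : ℝ) ^ (2 * k + 1) *
                Real.sqrt ((m₂ * n₂ : ℕ) : ℝ) ^ (2 * k + 1)) : ℝ) : ℂ)))) =
      ∑ k ∈ range K,
        ((2 * (π : ℂ) / (q : ℂ)) * (r : ℂ)⁻¹ *
          (((-1 : ℝ) ^ k / ((k ! : ℝ) * ((k + 1)! : ℝ)) * (2 * π / ((q : ℝ) * r)) ^ (2 * k + 1) : ℝ) : ℂ)) *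
        ∑ m₁ ∈ S₁, ∑ n₁ ∈ T₁, ∑ m₂ ∈ S₂, ∑ n₂ ∈ T₂,
          (X₁ m₁ * X₂ m₂ * ((Real.sqrt m₁ ^ (2 * k + 1) * Real.sqrt m₂ ^ (2 * k + 1) : ℝ) : ℂ)) *
            (W n₁ n₂ * ((Real.sqrt n₁ ^ (2 * k + 1) * Real.sqrt n₂ ^ (2 * k + 1) : ℝ) : ℂ)) *
            kloostermanSum (q * r) ((m₁ * n₁ : ℕ) : ZMod (q * r)) ((m₂ * n₂ : ℕ) : ZMod (q * r)) := by
  -- Step 1: write the truncated kernel as a finite sum of kernels `κ k`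
  have hker : ∀ a b : ℕ,
      (2 * (π : ℂ) / (q : ℂ)) * ((r : ℂ)⁻¹ *
        kloostermanSum (q * r) (a : ZMod (q * r)) (b : ZMod (q * r)) *
        ((∑ k ∈ range K, (-1 : ℝ) ^ k / ((k ! : ℝ) * ((k + 1)! : ℝ)) *
          ((2 * π / ((q : ℝ) * r)) ^ (2 * k + 1) * Real.sqrt (a : ℝ) ^ (2 * k + 1) *
            Real.sqrt (b : ℝ) ^ (2 * k + 1)) : ℝ) : ℂ)) =
      ∑ k ∈ range K, ((2 * (π : ℂ) / (q : ℂ)) * (r : ℂ)⁻¹ *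
          (((-1 : ℝ) ^ k / ((k ! : ℝ) * ((k + 1)! : ℝ)) * (2 * π / ((q : ℝ) * r)) ^ (2 * k + 1) : ℝ) : ℂ)) *
        (kloostermanSum (q * r) (a : ZMod (q * r)) (b : ZMod (q * r)) *
          ((Real.sqrt (a : ℝ) ^ (2 * k + 1) * Real.sqrt (b : ℝ) ^ (2 * k + 1) : ℝ) : ℂ)) := by
    intro a b
    push_cast
    rw [Finset.mul_sum, Finset.mul_sum]
    refine sum_congr rfl fun k _ ↦ ?_
    ring
  simp_rw [hker]
  refine (block_sum_range S₁ T₁ S₂ T₂ W X₁ X₂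
    (fun k a b ↦ ((2 * (π : ℂ) / (q : ℂ)) * (r : ℂ)⁻¹ *
          (((-1 : ℝ) ^ k / ((k ! : ℝ) * ((k + 1)! : ℝ)) * (2 * π / ((q : ℝ) * r)) ^ (2 * k + 1) : ℝ) : ℂ)) *
        (kloostermanSum (q * r) (a : ZMod (q * r)) (b : ZMod (q * r)) *
          ((Real.sqrt (a : ℝ) ^ (2 * k + 1) * Real.sqrt (b : ℝ) ^ (2 * k + 1) : ℝ) : ℂ))) K).trans ?_
  refine sum_congr rfl fun k _ ↦ ?_
  refine (block_const_mul S₁ T₁ S₂ T₂ W X₁ X₂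
    ((2 * (π : ℂ) / (q : ℂ)) * (r : ℂ)⁻¹ *
      (((-1 : ℝ) ^ k / ((k ! : ℝ) * ((k + 1)! : ℝ)) * (2 * π / ((q : ℝ) * r)) ^ (2 * k + 1) : ℝ) : ℂ))
    (fun a b ↦ kloostermanSum (q * r) (a : ZMod (q * r)) (b : ZMod (q * r)) *
      ((Real.sqrt (a : ℝ) ^ (2 * k + 1) * Real.sqrt (b : ℝ) ^ (2 * k + 1) : ℝ) : ℂ))).trans ?_
  congr 1
  exact block_taylor_term_eq (q * r) S₁ T₁ S₂ T₂ W X₁ X₂ k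

end Summit.Parity.GeneralizedHardyLittlewood.Theorems.MomentsBeyondDiagonal.Layers

end
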